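import Summits.KontsevichZagierPeriods.KontsevichZagierPeriods.Theorems.RealEllipticSectorKernel.Negative.Core
import Summits.KontsevichZagierPeriods.KontsevichZagierPeriods.Theorems.EllipticMomentKernel.Negative.Targets

/-!
# `RealEllipticSectorKernel` (stmt-KontsevichZagierPeriods-10632, route HermiteRigidity) — line
`oval-hermite-engine`, stub `stub_roots`

For a rational Weierstrass cubic `f = 4x³ − q₂x − q₃` with `Δ = q₂³ − 27q₃² > 0`: three real roots
`e₃ < e₂ < e₁`, each algebraic over `ℚ` (root of the non-zero cubic `4X³ − q₂X − q₃ ∈ ℚ[X]`), the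
factorisation `f = 4(x − e₁)(x − e₂)(x − e₃)`, and the three typed root-free sets of the crux
identified with intervals: `σ = (e₃, e₂)`, `σ' = (e₂, e₁)`, `σ'' = (e₁, ∞)`.

The roots, the factorisation, the sign pattern, `σ = (e₃, e₂)` and the algebraicity of the roots
are imported from the sibling crux `EllipticMomentKernel` (files `Negative/Roots.lean` and
`Negative/Targets.lean` under `…/Theorems/EllipticMomentKernel/`), whose `cubic`, `disc`, `oval`
have literally the same bodies as this crux's `cubic`, `discr`, `σ₁` (bridges by `rfl`). New here:
`σ' = (e₂, e₁)` and `σ'' = (e₁, ∞)`. [folklore]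
-/

noncomputable section

open MeasureTheory Set

namespace Summit.KontsevichZagierPeriods.HermiteRigidity.RealEllipticSectorKernel

open Literature.NumberTheory.Transcendental Literature.ModelTheory.ExponentialFields
open Summit.KontsevichZagierPeriods.RealEllipticSectorKernel.Negative

variable {q₂ q₃ : ℚ}

/-! ### Bridges to the sibling crux `EllipticMomentKernel` (same bodies, different constants) -/

/-- The sibling crux's `cubic` is this crux's `cubic` (same body). [folklore] -/
theorem roots_emk_cubic_eq : EllipticMomentKernelNegative.cubic = cubic := rfl

/-- The sibling crux's `disc` is this crux's `discr` (same body). [folklore] -/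
theorem roots_emk_disc_eq : EllipticMomentKernelNegative.disc = discr := rfl

/-- The sibling crux's `oval` is this crux's `σ₁` (same body). [folklore] -/
theorem roots_emk_oval_eq : EllipticMomentKernelNegative.oval = σ₁ := rfl

/-- Three located real roots `e₃ < e₂ < e₁` with `f = 4(x − e₃)(x − e₂)(x − e₁)` when `Δ > 0`
(transported from `EllipticMomentKernelNegative.exists_roots`). [folklore] -/
theorem roots_exists (h : 0 < discr q₂ q₃) :
    ∃ e₃ e₂ e₁ : ℝ, e₃ < e₂ ∧ e₂ < e₁ ∧
      ∀ x, cubic q₂ q₃ x = 4 * (x - e₃) * (x - e₂) * (x - e₁) := by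
  rw [← roots_emk_disc_eq] at h
  obtain ⟨e₃, e₂, e₁, h3, h2a, h2b, h1, hf⟩ := EllipticMomentKernelNegative.exists_roots h
  rw [roots_emk_cubic_eq] at hf
  exact ⟨e₃, e₂, e₁, h3.trans h2a, h2b.trans h1, hf⟩

/-- Sign pattern of the factored cubic: positive on `(e₃, e₂)`, negative on `(e₂, e₁)`, positive
on `(e₁, ∞)`, and `{f > 0} = (e₃, e₂) ∪ (e₁, ∞)` (transported from the sibling crux). [folklore] -/
theorem roots_cubic_signs {e₃ e₂ e₁ : ℝ} (h32 : e₃ < e₂) (h21 : e₂ < e₁)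
    (hf : ∀ x, cubic q₂ q₃ x = 4 * (x - e₃) * (x - e₂) * (x - e₁)) :
    (∀ x ∈ Ioo e₃ e₂, 0 < cubic q₂ q₃ x) ∧ (∀ x ∈ Ioo e₂ e₁, cubic q₂ q₃ x < 0) ∧
      (∀ x, e₁ < x → 0 < cubic q₂ q₃ x) ∧ (∀ x, 0 < cubic q₂ q₃ x → x ∈ Ioo e₃ e₂ ∨ e₁ < x) := by
  rw [← roots_emk_cubic_eq] at hf ⊢
  obtain ⟨hpos, hneg⟩ := EllipticMomentKernelNegative.cubic_sign_of_roots h32 h21 hf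
  exact ⟨hpos, hneg, fun x hx => EllipticMomentKernelNegative.cubic_pos_of_gt h32 h21 hf hx,
    fun x hx => EllipticMomentKernelNegative.mem_Ioo_or_gt_of_cubic_pos h32 h21 hf hx⟩

/-! ### The three typed root-free sets as intervals -/

/-- **`σ = (e₃, e₂)`** for the located roots (the sibling crux's `oval_eq_of_roots`). [folklore] -/
theorem roots_σ₁_eq {e₃ e₂ e₁ : ℝ} (h32 : e₃ < e₂) (h21 : e₂ < e₁)
    (hf : ∀ x, cubic q₂ q₃ x = 4 * (x - e₃) * (x - e₂) * (x - e₁)) :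
    σ₁ q₂ q₃ = {p | e₃ < p 0 ∧ p 0 < e₂} := by
  rw [← roots_emk_cubic_eq] at hf
  rw [← roots_emk_oval_eq, EllipticMomentKernelNegative.oval_eq_of_roots h32 h21 hf]
  rfl

/-- **`σ' = (e₂, e₁)`**: `f(x) < 0` puts `x` in `(−∞, e₃) ∪ (e₂, e₁)`, and a point `t < x` with
`f(t) > 0` lies in `(e₃, e₂)` (were `t > e₁`, also `f(x) > 0`), which excludes `(−∞, e₃]`;
conversely from `x ∈ (e₂, e₁)` take `t = (e₃ + e₂)/2`. [folklore] -/
theorem roots_σ₂_eq {e₃ e₂ e₁ : ℝ} (h32 : e₃ < e₂) (h21 : e₂ < e₁)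
    (hf : ∀ x, cubic q₂ q₃ x = 4 * (x - e₃) * (x - e₂) * (x - e₁)) :
    σ₂ q₂ q₃ = {p | e₂ < p 0 ∧ p 0 < e₁} := by
  obtain ⟨hpos, hneg, hgt, hcases⟩ := roots_cubic_signs h32 h21 hf
  ext p
  simp only [σ₂, mem_setOf_eq]
  constructor
  · rintro ⟨hp, t, htp, hft⟩
    -- the witness `t` lies in `(e₃, e₂)`: otherwise `e₁ < t < p 0` and `f (p 0) > 0`
    have h3 : e₃ < p 0 := by
      rcases hcases t hft with ht | ht
      · exact ht.1.trans htp
      · exact absurd hp (not_lt.2 (hgt _ (ht.trans htp)).le)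
    rw [hf] at hp
    have ha : 0 < p 0 - e₃ := sub_pos.2 h3
    constructor
    · by_contra h2
      push Not at h2
      -- `p 0 ∈ (e₃, e₂]`: the product `(p 0 − e₂)(p 0 − e₁)` of two nonpositive factors is `≥ 0`
      have hbc : 0 ≤ (p 0 - e₂) * (p 0 - e₁) :=
        mul_nonneg_of_nonpos_of_nonpos (by linarith) (by linarith)
      have : 0 ≤ 4 * (p 0 - e₃) * (p 0 - e₂) * (p 0 - e₁) := by
        rw [show 4 * (p 0 - e₃) * (p 0 - e₂) * (p 0 - e₁)
            = 4 * (p 0 - e₃) * ((p 0 - e₂) * (p 0 - e₁)) by ring]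
        positivity
      linarith
    · by_contra h1
      push Not at h1
      -- `e₁ ≤ p 0`: all three factors are `≥ 0`
      have hb : 0 ≤ p 0 - e₂ := by linarith
      have hc : 0 ≤ p 0 - e₁ := sub_nonneg.2 h1
      have : 0 ≤ 4 * (p 0 - e₃) * (p 0 - e₂) * (p 0 - e₁) := by positivity
      linarith
  · intro hp
    exact ⟨hneg _ hp, (e₃ + e₂) / 2, by linarith [hp.1], hpos _ ⟨by linarith, by linarith⟩⟩

/-- **`σ'' = (e₁, ∞)`**: `f(x) > 0` puts `x` in `(e₃, e₂) ∪ (e₁, ∞)`, and on `(e₃, e₂)` the point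
`t = (e₂ + e₁)/2 > x` has `f(t) < 0`; conversely right of `e₁` the cubic stays positive.
[folklore] -/
theorem roots_σ₃_eq {e₃ e₂ e₁ : ℝ} (h32 : e₃ < e₂) (h21 : e₂ < e₁)
    (hf : ∀ x, cubic q₂ q₃ x = 4 * (x - e₃) * (x - e₂) * (x - e₁)) :
    σ₃ q₂ q₃ = {p | e₁ < p 0} := by
  obtain ⟨-, hneg, hgt, hcases⟩ := roots_cubic_signs h32 h21 hf
  ext p
  simp only [σ₃, mem_setOf_eq]
  constructor
  · rintro ⟨hp, hall⟩
    rcases hcases _ hp with h | h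
    · exact absurd (hall ((e₂ + e₁) / 2) (by linarith [h.2]))
        (not_lt.2 (hneg _ ⟨by linarith, by linarith⟩).le)
    · exact h
  · intro hp
    exact ⟨hgt _ hp, fun t ht => hgt _ (hp.trans ht)⟩

/-! ### Algebraicity of the roots -/

/-- The three roots of the factored cubic are algebraic over `ℚ` (roots of the non-zero rational
cubic; the sibling crux's `isAlgebraic_of_cubic_eq_zero` and `cubic_roots_eq_zero`). [folklore] -/
theorem roots_isAlgebraic {e₃ e₂ e₁ : ℝ}
    (hf : ∀ x, cubic q₂ q₃ x = 4 * (x - e₃) * (x - e₂) * (x - e₁)) :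
    IsAlgebraic ℚ e₁ ∧ IsAlgebraic ℚ e₂ ∧ IsAlgebraic ℚ e₃ := by
  rw [← roots_emk_cubic_eq] at hf
  obtain ⟨h₃, h₂, h₁⟩ := EllipticMomentKernelNegative.cubic_roots_eq_zero hf
  exact ⟨EllipticMomentKernelNegative.isAlgebraic_of_cubic_eq_zero h₁,
    EllipticMomentKernelNegative.isAlgebraic_of_cubic_eq_zero h₂,
    EllipticMomentKernelNegative.isAlgebraic_of_cubic_eq_zero h₃⟩

/-! ### The stub -/

/-- **Stub `stub_roots`** (registered stub of crux stmt-KontsevichZagierPeriods-10632, line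
`oval-hermite-engine`). Three located real algebraic roots `e₃ < e₂ < e₁` of the rational cubic
with `Δ > 0`, the factorisation `f = 4(x−e₁)(x−e₂)(x−e₃)`, and the three typed ovals as intervals:
`σ = (e₃,e₂)`, `σ' = (e₂,e₁)`, `σ'' = (e₁,∞)`. [folklore] -/
theorem stub_roots (q₂ q₃ : ℚ) (hΔ : 0 < discr q₂ q₃) :
    ∃ e₁ e₂ e₃ : ℝ, e₃ < e₂ ∧ e₂ < e₁ ∧ IsAlgebraic ℚ e₁ ∧ IsAlgebraic ℚ e₂ ∧ IsAlgebraic ℚ e₃ ∧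
      (∀ x, cubic q₂ q₃ x = 4 * (x - e₁) * (x - e₂) * (x - e₃)) ∧
      σ₁ q₂ q₃ = {p | e₃ < p 0 ∧ p 0 < e₂} ∧
      σ₂ q₂ q₃ = {p | e₂ < p 0 ∧ p 0 < e₁} ∧
      σ₃ q₂ q₃ = {p | e₁ < p 0} := by
  obtain ⟨e₃, e₂, e₁, h32, h21, hf⟩ := roots_exists hΔ
  obtain ⟨ha₁, ha₂, ha₃⟩ := roots_isAlgebraic hf
  exact ⟨e₁, e₂, e₃, h32, h21, ha₁, ha₂, ha₃, fun x => by rw [hf]; ring,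
    roots_σ₁_eq h32 h21 hf, roots_σ₂_eq h32 h21 hf, roots_σ₃_eq h32 h21 hf⟩

end Summit.KontsevichZagierPeriods.HermiteRigidity.RealEllipticSectorKernel

end
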